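import Mathlib
import Summits.Ventures.HodgeRepro.Tier4.Common.TargetBall
import Summits.Ventures.HodgeRepro.Tier4.Common.DeepLevel
import Summits.Ventures.HodgeRepro.Tier4.Common.ConcreteCocompact

/-!
# Tier4/Line1/LevelDescent — cocompactness of the ball action descends to deeper levels

Blind re-derivation cell `pub-hodge-repro`, Tier 4 «prove the step» (README §9–§10), seat t4-L1-p2 (gen 3), LINE L1
(the relative-trace-formula line).  Target tree path `lean/Summits/Ventures/HodgeRepro/Tier4/Line1/LevelDescent.lean`.
Imports: typer-2's `TargetBall` (the ball action `actM` is an action of `U(2,1)` on the ball, continuous, and the transfer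
`toBallMat` is multiplicative and lands in `U(2,1)`), typer-1's `DeepLevel` (`Γ′ ∩ Γ(N)` is a level) and
`ConcreteCocompact` (`TargetData.IsCocompact`, the shape of the printed Borel–Harish-Chandra input).

WHAT IS PROVED (Mathlib + the named modules only, no printed input).
* `exists_finset_reps_inter_principal`: for a congruence subgroup `Γ′` of `U(H)` and `N ≥ 1`, the subgroup
  `Γ′ ∩ Γ(N)` has FINITE INDEX in `Γ′`, in the explicit form «a finite set `S ⊆ Γ′` of left-coset representatives:
  every `g ∈ Γ′` is `s * h` with `s ∈ S`, `h ∈ Γ′ ∩ Γ(N)`» — by reduction of the (algebraic-integer) entries modulo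
  `N` in the finite ring `𝓞_E ⧸ (N)` (Mathlib's `Ideal.finiteQuotientOfFreeOfNeBot`): two elements of `Γ′` with the
  same reduction differ by an element of `Γ(N)`.
* `TargetData.isCocompact_of_finset_reps`: the cocompactness `d.IsCocompact Γ′` (some compact `K ⊆ 𝔹²` meets every
  `Γ′`-orbit) DESCENDS along a finite set of coset representatives to `Γ″ ⊆ Γ′`: the finite union of the translates
  `γ_s⁻¹ · K` (`s ∈ S`) is compact in the ball and meets every `Γ″`-orbit (`h · z = s⁻¹ · (g · z)` for `g = s h`).
* `TargetData.isCocompact_inter_principal` / `isCocompact_Γ_inter_principal`: hence `d.IsCocompact (Γ′ ∩ Γ(N))` for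
  every level `Γ′` with `d.IsCocompact Γ′` and every `N ≥ 1` — in particular the cocompactness of the base level
  `Γ` of the datum gives the cocompactness of EVERY deep level `Γ ∩ Γ(N)` of the tower.

WHY (LINE L1, the costume's (I0)).  The costume's level is a DEEP level at the split place `v₀` (the TOWER reading of
the Hecke translates), and its cocompactness `hcc` is the line's one printed input on the geometric side, taken from
lit-3's `Lit.BorelHarishChandra1962_Thm11_8_cocompact_hdef` through typer-1's `isCocompact_of_BHC` at every level.
This file is the kernel twin of the docstring sentence «`hcc = isCocompact_of_BHC hBHC hΓ'` at every level»: the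
printed input is needed at ONE level only — the base level `Γ` of the datum, exactly as typer-1's `P_T4_of_concrete_K`
displays it at the target — and every deeper level of the tower (L1's level at `v₀`, L3's `Γ ∩ Γ(q₀^N)`) inherits it
by the finite-index descent proved here.  DISCLOSED: this removes nothing from the printed statement (Borel–Harish-
Chandra is printed for every arithmetic subgroup); it is a theorem about the tree's own `IsCocompact`.

Nothing here says anything about the status of the Hodge conjecture for CM abelian varieties, which is NOT proved
(HC_CM is NOT proved by anyone in this repository).
-/

set_option autoImplicit false

noncomputable section

open Matrix NumberField

namespace Summit.Ventures.HodgeRepro.Tier4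

/-! ## 1. Finite index of `Γ′ ∩ Γ(N)` in a congruence subgroup `Γ′`: reduction of the entries modulo `N` -/

section Reps

variable {E : Type} [Field E] {c : E ≃+* E} {H : Matrix (Fin 3) (Fin 3) E}

/-- **Two integral matrices whose entries have the same classes modulo an ideal `(N)` of `𝓞_E` are congruent modulo
`N` entry by entry** (the classes are taken in `𝓞_E ⧸ (N)`). -/
theorem exists_eq_mul_of_mk_eq {N : ℕ} {g s : Matrix (Fin 3) (Fin 3) E} (hg : IsIntegralMatrix g)
    (hs : IsIntegralMatrix s)
    (hred : ∀ i j, (Ideal.Quotient.mk (Ideal.span {(N : 𝓞 E)}) ⟨g i j, hg i j⟩ : 𝓞 E ⧸ Ideal.span {(N : 𝓞 E)}) =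
      Ideal.Quotient.mk (Ideal.span {(N : 𝓞 E)}) ⟨s i j, hs i j⟩)
    (i j : Fin 3) : ∃ x : E, IsIntegral ℤ x ∧ g i j - s i j = (N : E) * x := by
  have hij := hred i j
  rw [Ideal.Quotient.eq, Ideal.mem_span_singleton'] at hij
  obtain ⟨x, hx⟩ := hij
  refine ⟨(x : E), RingOfIntegers.isIntegral_coe x, ?_⟩
  have hx' := congrArg (fun y : 𝓞 E => (y : E)) hx
  simp only [map_mul, map_natCast, map_sub, RingOfIntegers.map_mk] at hx'
  rw [← hx']
  ring

/-- **`Γ′ ∩ Γ(N)` has finite index in the congruence subgroup `Γ′`** (`N ≥ 1`): a finite set `S ⊆ Γ′` of left-coset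
representatives — every `g ∈ Γ′` is `s * h` with `s ∈ S` and `h ∈ Γ′ ∩ Γ(N)`.  The representatives are chosen in the
fibres of the reduction of the entries `Γ′ → M₃(𝓞_E ⧸ (N))`, a map into a FINITE set. -/
theorem exists_finset_reps_inter_principal [NumberField E] {Γ' : Set (Matrix (Fin 3) (Fin 3) E)}
    (hΓ' : IsCongruenceSubgroup c H Γ') {N : ℕ} (hN : 1 ≤ N) :
    ∃ S : Finset (Matrix (Fin 3) (Fin 3) E), ↑S ⊆ Γ' ∧
      ∀ g ∈ Γ', ∃ s ∈ S, ∃ h ∈ Γ' ∩ principalCongruence c H N, g = s * h := by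
  classical
  set I : Ideal (𝓞 E) := Ideal.span {(N : 𝓞 E)} with hI
  have hIbot : I ≠ ⊥ := by
    rw [hI, Ne, Ideal.span_singleton_eq_bot]
    exact_mod_cast (show N ≠ 0 by omega)
  haveI : Finite (𝓞 E ⧸ I) := Ideal.finiteQuotientOfFreeOfNeBot I hIbot
  haveI : Finite (Matrix (Fin 3) (Fin 3) (𝓞 E ⧸ I)) := inferInstanceAs (Finite (Fin 3 → Fin 3 → (𝓞 E ⧸ I)))
  -- the reduction of the entries modulo `N` (junk `0` at a non-integral entry); the image of `Γ′` under it is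
  -- finite; pick one preimage in `Γ′` per class
  set red : Matrix (Fin 3) (Fin 3) E → Matrix (Fin 3) (Fin 3) (𝓞 E ⧸ I) :=
    fun g i j => if h : IsIntegral ℤ (g i j) then Ideal.Quotient.mk I ⟨g i j, h⟩ else 0 with hred
  have hfin : (red '' Γ').Finite := Set.toFinite _
  refine ⟨hfin.toFinset.image (Function.invFunOn red Γ'), ?_, ?_⟩
  · intro s hs
    simp only [Finset.coe_image, Set.Finite.coe_toFinset, Set.mem_image] at hs
    obtain ⟨t, ⟨g, hg, rfl⟩, rfl⟩ := hs
    exact Function.invFunOn_mem ⟨g, hg, rfl⟩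
  · intro g hg
    set s := Function.invFunOn red Γ' (red g) with hsdef
    have hsΓ : s ∈ Γ' := Function.invFunOn_mem ⟨g, hg, rfl⟩
    have hsred : red s = red g := Function.invFunOn_eq ⟨g, hg, rfl⟩
    -- an inverse of `s` in `Γ′`
    obtain ⟨k, hkΓ, hsk⟩ := hΓ'.2.2.1 s hsΓ
    have hks : k * s = 1 := mul_eq_one_comm.1 hsk
    refine ⟨s, ?_, k * g, ⟨hΓ'.2.1 k hkΓ g hg, ?_⟩, ?_⟩
    · simp only [Finset.mem_image, Set.Finite.mem_toFinset, Set.mem_image]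
      exact ⟨red g, ⟨g, hg, rfl⟩, rfl⟩
    · -- `k g ∈ Γ(N)`: unitary and integral as an element of `Γ′ ⊆ Γ(1)`; `k g − 1 = k (g − s)` with `g ≡ s mod N`
      have hkg : k * g ∈ principalCongruence c H 1 := hΓ'.2.2.2.1 (hΓ'.2.1 k hkΓ g hg)
      have hkint : IsIntegralMatrix k := (hΓ'.2.2.2.1 hkΓ).2.1
      have hgint : IsIntegralMatrix g := (hΓ'.2.2.2.1 hg).2.1
      have hsint : IsIntegralMatrix s := (hΓ'.2.2.2.1 hsΓ).2.1
      refine ⟨hkg.1, hkg.2.1, fun i j => ?_⟩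
      have hmk : ∀ i j, (Ideal.Quotient.mk I ⟨g i j, hgint i j⟩ : 𝓞 E ⧸ I) =
          Ideal.Quotient.mk I ⟨s i j, hsint i j⟩ := by
        intro i j
        have h1 := congrFun (congrFun hsred i) j
        simp only [hred, dif_pos (hgint i j), dif_pos (hsint i j)] at h1
        exact h1.symm
      choose x hx using exists_eq_mul_of_mk_eq hgint hsint hmk
      have hsub : k * g - 1 = k * (g - s) := by
        rw [Matrix.mul_sub, hks]
      have hentry := congrFun (congrFun hsub i) j
      rw [Matrix.sub_apply] at hentry
      rw [hentry]
      refine ⟨∑ l, k i l * x l j, IsIntegral.sum _ fun l _ => (hkint i l).mul (hx l j).1, ?_⟩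
      simp only [Matrix.mul_apply, Matrix.sub_apply, Fin.sum_univ_three]
      rw [(hx 0 j).2, (hx 1 j).2, (hx 2 j).2]
      ring
    · rw [← Matrix.mul_assoc, hsk, Matrix.one_mul]

end Reps

/-! ## 2. Cocompactness of the ball action descends along finite coset representatives -/

namespace TargetData

variable {F E : Type} [Field F] [NumberField F] [IsGalois ℚ F] [IsCMField F]
  [Field E] [NumberField E] [IsGalois ℚ E] [IsCMField E] (d : TargetData F E)

/-- The transfer of a unitary matrix of the datum lies in `U(2,1)` (typer-2's `toBallMat_J` on the datum's
`(H, τ₀, C)`). -/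
theorem toBallMat_J_of_isUnitaryOf {g : Matrix (Fin 3) (Fin 3) E} (hg : IsUnitaryOf (conjE E) d.H g) :
    (toBallMat d.τ₀ d.C g)ᴴ * J * toBallMat d.τ₀ d.C g = J :=
  toBallMat_J d.τ₀ (conjE E) (fun x => complexConj_intertwines E d.τ₀ x) d.hC hg

/-- The ball action of the datum is an action on the ball: `d.act (g * h) z = d.act g (d.act h z)` for `h ∈ U(H)`. -/
theorem act_mul_of_isUnitaryOf (g : Matrix (Fin 3) (Fin 3) E) {h : Matrix (Fin 3) (Fin 3) E}
    (hh : IsUnitaryOf (conjE E) d.H h) {z : Fin 2 → ℂ} (hz : z ∈ ball) :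
    d.act (g * h) z = d.act g (d.act h z) := by
  simp only [act]
  rw [toBallMat_mul d.τ₀ d.hC.1, actM_mul (d.toBallMat_J_of_isUnitaryOf hh) hz]

/-- The ball action of a unitary matrix of the datum preserves the ball. -/
theorem act_mem_ball_of_isUnitaryOf {g : Matrix (Fin 3) (Fin 3) E} (hg : IsUnitaryOf (conjE E) d.H g)
    {z : Fin 2 → ℂ} (hz : z ∈ ball) : d.act g z ∈ ball :=
  actM_mem_ball (d.toBallMat_J_of_isUnitaryOf hg) hz

/-- The ball action of a unitary matrix of the datum is continuous on the ball. -/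
theorem continuousOn_act_of_isUnitaryOf {g : Matrix (Fin 3) (Fin 3) E} (hg : IsUnitaryOf (conjE E) d.H g) :
    ContinuousOn (d.act g) ball :=
  continuousOn_actM (d.toBallMat_J_of_isUnitaryOf hg)

/-- **Cocompactness descends along a finite set of coset representatives**: if some compact `K ⊆ 𝔹²` meets every
`Γ′`-orbit, `Γ′` is a congruence subgroup, and `S ⊆ Γ′` is a finite set with every `g ∈ Γ′` of the form `s * h`
(`s ∈ S`, `h ∈ Γ″`), then the finite union of the translates `s⁻¹ · K` is a compact subset of the ball meeting every
`Γ″`-orbit: for `z ∈ 𝔹²` pick `g ∈ Γ′` with `g · z ∈ K` and write `g = s h`; then `h · z = s⁻¹ · (g · z)`. -/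
theorem isCocompact_of_finset_reps {Γ' Γ'' : Set (Matrix (Fin 3) (Fin 3) E)}
    (hΓ' : IsCongruenceSubgroup (conjE E) d.H Γ') (hcc : d.IsCocompact Γ')
    (S : Finset (Matrix (Fin 3) (Fin 3) E)) (hSΓ : ↑S ⊆ Γ')
    (hS : ∀ g ∈ Γ', ∃ s ∈ S, ∃ h ∈ Γ'', g = s * h) : d.IsCocompact Γ'' := by
  classical
  obtain ⟨K, hK, hKb, hmeet⟩ := hcc
  -- an inverse in `Γ′` of every element of `Γ′`
  have hinv : ∀ s ∈ Γ', ∃ k ∈ Γ', s * k = 1 := hΓ'.2.2.1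
  choose! inv hinvΓ hinv_mul using hinv
  have hunit : ∀ g ∈ Γ', IsUnitaryOf (conjE E) d.H g := fun g hg => (hΓ'.2.2.2.1 hg).1
  refine ⟨⋃ s ∈ S, d.act (inv s) '' K, ?_, ?_, ?_⟩
  · -- compact: a finite union of continuous images of the compact `K`
    refine S.isCompact_biUnion fun s hs => hK.image_of_continuousOn ?_
    exact (d.continuousOn_act_of_isUnitaryOf (hunit _ (hinvΓ s (hSΓ hs)))).mono hKb
  · -- inside the ball
    intro w hw
    simp only [Set.mem_iUnion, Set.mem_image] at hw
    obtain ⟨s, hs, z, hz, rfl⟩ := hw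
    exact d.act_mem_ball_of_isUnitaryOf (hunit _ (hinvΓ s (hSΓ hs))) (hKb hz)
  · -- meets every `Γ″`-orbit
    intro z hz
    obtain ⟨g, hg, hgz⟩ := hmeet z hz
    obtain ⟨s, hs, h, hh, rfl⟩ := hS g hg
    refine ⟨h, hh, ?_⟩
    have hsΓ : s ∈ Γ' := hSΓ hs
    have hks : inv s * s = 1 := mul_eq_one_comm.1 (hinv_mul s hsΓ)
    have hact : d.act h z = d.act (inv s) (d.act (s * h) z) := by
      rw [← d.act_mul_of_isUnitaryOf (inv s) (hunit _ hg) hz, ← Matrix.mul_assoc, hks, Matrix.one_mul]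
    rw [hact]
    simp only [Set.mem_iUnion, Set.mem_image]
    exact ⟨s, hs, d.act (s * h) z, hgz, rfl⟩

/-- **Cocompactness of a level descends to `Γ′ ∩ Γ(N)`** (`N ≥ 1`): from the finite index
(`exists_finset_reps_inter_principal`) and the descent (`isCocompact_of_finset_reps`). -/
theorem isCocompact_inter_principal {Γ' : Set (Matrix (Fin 3) (Fin 3) E)}
    (hΓ' : IsCongruenceSubgroup (conjE E) d.H Γ') (hcc : d.IsCocompact Γ') {N : ℕ} (hN : 1 ≤ N) :
    d.IsCocompact (Γ' ∩ principalCongruence (conjE E) d.H N) := by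
  obtain ⟨S, hSΓ, hS⟩ := exists_finset_reps_inter_principal hΓ' hN
  exact d.isCocompact_of_finset_reps hΓ' hcc S hSΓ hS

/-- **The tower**: the cocompactness of the base level `Γ` of the datum (the ONE printed input, as
`P_T4_of_concrete_K` displays it) gives the cocompactness of every deep level `Γ ∩ Γ(N)`, `N ≥ 1`. -/
theorem isCocompact_Γ_inter_principal (hcc : d.IsCocompact d.Γ) {N : ℕ} (hN : 1 ≤ N) :
    d.IsCocompact (d.Γ ∩ principalCongruence (conjE E) d.H N) :=
  d.isCocompact_inter_principal d.hΓ hcc hN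

/-- **Every deep level of the tower is a cocompact level** of the datum, from the cocompactness of the base level:
the level property by typer-1's `isLevel_inter_principal`, the cocompactness by descent. -/
theorem isLevel_and_isCocompact_inter_principal (hcc : d.IsCocompact d.Γ) {N : ℕ} (hN : 1 ≤ N) :
    d.IsLevel (d.Γ ∩ principalCongruence (conjE E) d.H N) ∧
      d.IsCocompact (d.Γ ∩ principalCongruence (conjE E) d.H N) :=
  ⟨d.isLevel_inter_principal hN, d.isCocompact_Γ_inter_principal hcc hN⟩

end TargetData

end Summit.Ventures.HodgeRepro.Tier4

end
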